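import Mathlib
import HarnessLib
import Summits.HubbardSuperconductivity.HubbardSuperconductivity.Theorems.KLProgrammeKLRegimeSplitSymInterpExact
import Summits.HubbardSuperconductivity.HubbardSuperconductivity.Theorems.KLProgrammeKLRegimeCountertermProfileSymmetry
import Summits.HubbardSuperconductivity.HubbardSuperconductivity.Theorems.KLProgrammeC4aMomentumKernelTrigPoly

/-!
# Route `KLProgramme` — crux C4a, the tadpole representation, step (iii): the symmetrised interpolant is EXACT on character data,
# and along the frame's Fermi curve it is the average over the eight `D₄`-images OF THE ANGLE

Cell `gate-hubbard-kl`, lane hubbard-kl-c4a-1 (g5); helper for stub (C) `stub_twoLeg_curvature` of the engine-flow child `KLRegimeEngineV17F2`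
(stmt-HubbardSuperconductivity-20437); memo HOME/hubbard-kl-c4a-1/C4A-PLAN.md §16.4 (3), §16.5 (iii)/(iii′).  LAYER 1 (`…TwoLegIncrementRepReading`
§4 `klLocalPart_succ_sub_eq`) reads the scale increment of the local part as `(symInterp L T).eval (klFermiPoint μ K θ)` for a lattice reading `T`;
by `…C4aMomentumKernelTrigPoly` (§3 loop legs, §5 external pair) the tadpole reading is `T(k⃗) = Re Σ_i a_i·χ_{k⃗}(z_i)` — the real part of a
complex-linear combination of CHARACTERS of the external lattice momentum, with coefficients free of `k⃗`.  On such data `symInterp` needs no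
aliasing estimate at all:

* §1 `torusCosCoeff_torusChar_re/_im` — the cosine coefficients of `Re χ_·(z)` are `½([x = −z] + [x = z])`, those of `Im χ_·(z)` vanish
  (character orthogonality `sum_torusChar_mul_torusChar`);
* §2 **`eval_symInterp_torusChar_re`** — `(symInterp L (Re χ_·(z))).eval P = h_{|z̃₀|,|z̃₁|}(P)` at EVERY continuum momentum (`z̃ = valMinAbs`, no
  degree condition), `eval_symInterp_torusChar_im` (`= 0`), and the complex-linear form **`eval_symInterp_re_sum_mul_torusChar`**:
  `I_L[Re Σ_i a_i χ_·(z_i)](P) = Re Σ_i a_i·h_{z̃_i}(P)`;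
* §3 `charPoly s a z P = Σ_i a_i·e^{i P·z̃_i}` (def) — the trigonometric polynomial with CENTRED frequencies whose lattice samples are the data
  (`charPoly_latticeMomentum`); `harmonic_natAbs_eq_cos4` (`h_{|m|,|n|}(P)` = the average of `cos(P′·(m,n))` over the four reflections `P′` of `P`);
* §4 **`eval_symInterp_re_charPoly_klFermiPoint`** — along the Fermi curve of ANY frame `K : TrigPolyC4v` the four reflected momenta are the
  Fermi points at the four reflected ANGLES (`klFermiPoint_neg/_pi_div_two_sub/_add_pi`), so
  `(symInterp L T).eval (k_F(θ)) = ⅛ Σ_{θ′} Re charPoly(k_F(θ′))`, `θ′ ∈ {θ, −θ, π/2 − θ, π/2 + θ} + {0, π}` — EXACT, model-free: the jets of the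
  interpolated reading at `θ` are averages of the jets of ONE smooth function `θ′ ↦ Re charPoly(k_F(θ′))` (the true continuum vertex read at the
  Fermi point) at eight angles.  No `D₄`-covariance of the kernels is used (the interpolant symmetrises), and the co-moving analysis (L3) is run on
  the un-symmetrised `charPoly` (a vertex symmetrised in its external slot alone is NOT co-moving-soft under the reflections).

Exact identities; nothing is asserted about the Hubbard model.  References: BGM 2006 §2.3 (2.17), §2.4 [cite: BenfattoGiulianiMastropietro2006];
Zygmund, *Trigonometric Series* X §2 (interpolation of trigonometric polynomials) [cite: Zygmund2002].
-/

noncomputable section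

namespace Summit.HubbardSuperconductivity.HubbardSuperconductivity.Theorems.C4a

set_option linter.dupNamespace false -- summit = problem name (single-conjunct summit), D-0017

open Real Finset Literature.MathematicalPhysics.QuantumLattice Literature.Probability.LatticeModels
open Summit.HubbardSuperconductivity.HubbardSuperconductivity.Theorems.KLRegimeSplit

variable {L : ℕ} [NeZero L]

/-! ## §1 The cosine coefficients of character data -/

/-- `Re χ_k(z)·Re χ_k(x) = ½·Re[χ_k(z)χ_k(x) + χ_k(z)χ_k(−x)]`. -/
private theorem re_mul_re_torusChar (k z x : TorusSite 2 L) :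
    (torusChar k z).re * (torusChar k x).re =
      ((torusChar k z * torusChar k x).re + (torusChar k z * torusChar k (-x)).re) / 2 := by
  rw [torusChar_neg_right, Complex.mul_re, Complex.mul_re, Complex.conj_re, Complex.conj_im]
  ring

/-- `Im χ_k(z)·Re χ_k(x) = ½·Im[χ_k(z)χ_k(x) + χ_k(z)χ_k(−x)]`. -/
private theorem im_mul_re_torusChar (k z x : TorusSite 2 L) :
    (torusChar k z).im * (torusChar k x).re =
      ((torusChar k z * torusChar k x).im + (torusChar k z * torusChar k (-x)).im) / 2 := by
  rw [torusChar_neg_right, Complex.mul_im, Complex.mul_im, Complex.conj_re, Complex.conj_im]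
  ring

/-- **Cosine coefficients of the real part of a character**: `(Re χ_·(z))_c(x) = ½([x = −z] + [x = z])`. [cite: BenfattoGiulianiMastropietro2006, §2.3 (2.17)] -/
theorem torusCosCoeff_torusChar_re (z x : TorusSite 2 L) :
    torusCosCoeff L (fun k => (torusChar k z).re) x =
      ((if x = -z then (1 : ℝ) else 0) + (if x = z then (1 : ℝ) else 0)) / 2 := by
  classical
  have hL : ((L : ℝ) ^ 2) ≠ 0 := pow_ne_zero _ (Nat.cast_ne_zero.2 (NeZero.ne L))
  have h1 : (∑ k : TorusSite 2 L, torusChar k z * torusChar k x).re = if x = -z then (L : ℝ) ^ 2 else 0 := by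
    rw [sum_torusChar_mul_torusChar]
    split_ifs
    · rw [← Complex.ofReal_natCast, ← Complex.ofReal_pow, Complex.ofReal_re]
    · simp
  have h2 : (∑ k : TorusSite 2 L, torusChar k z * torusChar k (-x)).re = if x = z then (L : ℝ) ^ 2 else 0 := by
    rw [sum_torusChar_mul_torusChar]
    simp only [neg_inj]
    split_ifs
    · rw [← Complex.ofReal_natCast, ← Complex.ofReal_pow, Complex.ofReal_re]
    · simp
  unfold torusCosCoeff
  simp_rw [cos_sum_latticeMomentum_mul_valMinAbs, re_mul_re_torusChar]
  rw [← Finset.sum_div, Finset.sum_add_distrib, ← Complex.re_sum, ← Complex.re_sum, h1, h2,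
    show ((if x = -z then (L : ℝ) ^ 2 else 0) + (if x = z then (L : ℝ) ^ 2 else 0)) =
      (L : ℝ) ^ 2 * ((if x = -z then (1 : ℝ) else 0) + (if x = z then (1 : ℝ) else 0)) by split_ifs <;> ring,
    mul_div_assoc, ← mul_assoc, inv_mul_cancel₀ hL, one_mul]

/-- **Cosine coefficients of the imaginary part of a character vanish** (the interpolant is blind to the odd part of the data).
[cite: BenfattoGiulianiMastropietro2006, §2.3 (2.17)] -/
theorem torusCosCoeff_torusChar_im (z x : TorusSite 2 L) :
    torusCosCoeff L (fun k => (torusChar k z).im) x = 0 := by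
  classical
  have h1 : (∑ k : TorusSite 2 L, torusChar k z * torusChar k x).im = 0 := by
    rw [sum_torusChar_mul_torusChar]
    split_ifs
    · rw [← Complex.ofReal_natCast, ← Complex.ofReal_pow, Complex.ofReal_im]
    · simp
  have h2 : (∑ k : TorusSite 2 L, torusChar k z * torusChar k (-x)).im = 0 := by
    rw [sum_torusChar_mul_torusChar]
    split_ifs
    · rw [← Complex.ofReal_natCast, ← Complex.ofReal_pow, Complex.ofReal_im]
    · simp
  unfold torusCosCoeff
  simp_rw [cos_sum_latticeMomentum_mul_valMinAbs, im_mul_re_torusChar]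
  rw [← Finset.sum_div, Finset.sum_add_distrib, ← Complex.im_sum, ← Complex.im_sum, h1, h2]
  simp

/-! ## §2 The symmetrised interpolant of character data -/

/-- **EXACTNESS ON CHARACTERS.**  For every site `z` and EVERY continuum momentum `P`:
`(symInterp L (Re χ_·(z))).eval P = h_{|z̃₀|,|z̃₁|}(P)` (`z̃ = valMinAbs z`; both sites `±z` carry the same harmonic). [cite: Zygmund2002, Ch. X §2] -/
theorem eval_symInterp_torusChar_re (z : TorusSite 2 L) (P : Fin 2 → ℝ) :
    (symInterp L (fun k => (torusChar k z).re)).eval P =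
      TrigPolyC4v.harmonic (z 0).valMinAbs.natAbs (z 1).valMinAbs.natAbs P := by
  classical
  rw [eval_symInterp]
  simp_rw [torusCosCoeff_torusChar_re, add_div, add_mul, Finset.sum_add_distrib, ite_div, zero_div, ite_mul, zero_mul]
  rw [Finset.sum_ite_eq' Finset.univ (-z), Finset.sum_ite_eq' Finset.univ z]
  simp only [Finset.mem_univ, if_true, Pi.neg_apply, ZMod.natAbs_valMinAbs_neg]
  ring

/-- The interpolant of `Im χ_·(z)` vanishes identically. [cite: Zygmund2002, Ch. X §2] -/
theorem eval_symInterp_torusChar_im (z : TorusSite 2 L) (P : Fin 2 → ℝ) :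
    (symInterp L (fun k => (torusChar k z).im)).eval P = 0 := by
  rw [eval_symInterp]
  simp_rw [torusCosCoeff_torusChar_im, zero_mul, Finset.sum_const_zero]

/-- **Complex-linear combinations of characters.**  For coefficients `a_i ∈ ℂ` and sites `z_i` free of the lattice momentum:
`(symInterp L (k⃗ ↦ Re Σ_{i∈s} a_i χ_k⃗(z_i))).eval P = Re Σ_{i∈s} a_i·h_{|z̃_{i,0}|,|z̃_{i,1}|}(P)`. [cite: Zygmund2002, Ch. X §2] -/
theorem eval_symInterp_re_sum_mul_torusChar {ι : Type*} (s : Finset ι) (a : ι → ℂ) (z : ι → TorusSite 2 L) (P : Fin 2 → ℝ) :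
    (symInterp L (fun k => (∑ i ∈ s, a i * torusChar k (z i)).re)).eval P =
      (∑ i ∈ s, a i * (TrigPolyC4v.harmonic ((z i) 0).valMinAbs.natAbs ((z i) 1).valMinAbs.natAbs P : ℂ)).re := by
  have hdata : (fun k : TorusSite 2 L => (∑ i ∈ s, a i * torusChar k (z i)).re) =
      fun k => ∑ i ∈ s, ((a i).re * (torusChar k (z i)).re - (a i).im * (torusChar k (z i)).im) := by
    funext k
    rw [Complex.re_sum]
    exact Finset.sum_congr rfl fun i _ => Complex.mul_re _ _
  rw [hdata, eval_symInterp_finset_sum, Complex.re_sum]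
  refine Finset.sum_congr rfl fun i _ => ?_
  rw [eval_symInterp_sub L (fun k => (a i).re * (torusChar k (z i)).re) (fun k => (a i).im * (torusChar k (z i)).im),
    eval_symInterp_const_mul, eval_symInterp_const_mul, eval_symInterp_torusChar_re, eval_symInterp_torusChar_im,
    mul_zero, sub_zero, Complex.mul_re, Complex.ofReal_re, Complex.ofReal_im, mul_zero, sub_zero]

/-! ## §3 The continuum extension of character data, and the harmonic as an average over the four reflections -/

/-- **The trigonometric polynomial with centred frequencies** attached to character data: `charPoly s a z P = Σ_{i∈s} a_i·e^{i Σ_j P_j·z̃_{i,j}}`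
(`z̃ = valMinAbs`, so `2|z̃_{i,j}| ≤ L`); its samples at the lattice momenta are the data `Σ_i a_i χ_{k⃗}(z_i)` (`charPoly_latticeMomentum`). -/
def charPoly {ι : Type*} (s : Finset ι) (a : ι → ℂ) (z : ι → TorusSite 2 L) (P : Fin 2 → ℝ) : ℂ :=
  ∑ i ∈ s, a i * Complex.exp (((∑ j, P j * (((z i) j).valMinAbs : ℝ) : ℝ) : ℂ) * Complex.I)

/-- `charPoly` sampled at a lattice momentum is the character combination. [cite: BenfattoGiulianiMastropietro2006, §2.1 (2.3)] -/
theorem charPoly_latticeMomentum {ι : Type*} (s : Finset ι) (a : ι → ℂ) (z : ι → TorusSite 2 L) (k : TorusSite 2 L) :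
    charPoly s a z (latticeMomentum L k) = ∑ i ∈ s, a i * torusChar k (z i) := by
  unfold charPoly
  refine Finset.sum_congr rfl fun i _ => ?_
  rw [torusChar_eq_cexp_valMinAbs]

omit [NeZero L] in
/-- `charPoly` at the negated momentum pairs with `charPoly` at the momentum into a cosine:
`Re charPoly(P) + Re charPoly(−P) = 2·Re Σ_i a_i cos(P·z̃_i)`. -/
theorem charPoly_re_add_charPoly_neg_re {ι : Type*} (s : Finset ι) (a : ι → ℂ) (z : ι → TorusSite 2 L) (P : Fin 2 → ℝ) :
    (charPoly s a z P).re + (charPoly s a z (-P)).re =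
      2 * (∑ i ∈ s, a i * (Real.cos (∑ j, P j * (((z i) j).valMinAbs : ℝ)) : ℂ)).re := by
  unfold charPoly
  rw [← Complex.add_re, ← Finset.sum_add_distrib, Complex.re_sum, Complex.re_sum, Finset.mul_sum]
  refine Finset.sum_congr rfl fun i _ => ?_
  have hneg : (∑ j, (-P) j * (((z i) j).valMinAbs : ℝ)) = -∑ j, P j * (((z i) j).valMinAbs : ℝ) := by
    rw [← Finset.sum_neg_distrib]
    exact Finset.sum_congr rfl fun j _ => by rw [Pi.neg_apply, neg_mul]
  rw [hneg, Complex.ofReal_neg, ← mul_add, ← Complex.two_cos, ← Complex.ofReal_cos, ← mul_assoc, mul_comm (a i) 2, mul_assoc,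
    show (2 : ℂ) = ((2 : ℝ) : ℂ) by norm_num, Complex.re_ofReal_mul]

/-- `cos(|m|·x) = cos(m·x)` for an integer frequency. -/
private theorem cos_natAbs_mul (m : ℤ) (x : ℝ) : Real.cos ((m.natAbs : ℝ) * x) = Real.cos ((m : ℝ) * x) := by
  have h : ((m.natAbs : ℕ) : ℝ) = |(m : ℝ)| := by
    rw [← Int.cast_natCast, Int.natCast_natAbs, Int.cast_abs]
  rw [h]
  rcases abs_choice (m : ℝ) with h' | h'
  · rw [h']
  · rw [h', neg_mul, Real.cos_neg]

/-- **The harmonic is the average of the plane cosine over the four reflections**: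
`h_{|m|,|n|}(P) = ¼[cos(P₀m + P₁n) + cos(P₀m − P₁n) + cos(P₁m + P₀n) + cos(−P₁m + P₀n)]`. [folklore] -/
theorem harmonic_natAbs_eq_cos4 (m n : ℤ) (P : Fin 2 → ℝ) :
    TrigPolyC4v.harmonic m.natAbs n.natAbs P =
      (Real.cos (P 0 * m + P 1 * n) + Real.cos (P 0 * m + -P 1 * n) + Real.cos (P 1 * m + P 0 * n) +
        Real.cos (-P 1 * m + P 0 * n)) / 4 := by
  unfold TrigPolyC4v.harmonic
  rw [cos_natAbs_mul, cos_natAbs_mul, cos_natAbs_mul, cos_natAbs_mul, Real.cos_add, Real.cos_add, Real.cos_add, Real.cos_add]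
  simp only [neg_mul, Real.cos_neg, Real.sin_neg, mul_comm (P 0), mul_comm (P 1)]
  ring

omit [NeZero L] in
/-- The sum over the two coordinates, spelled out. -/
private theorem sum_two_mul_valMinAbs (P : Fin 2 → ℝ) (z : TorusSite 2 L) :
    (∑ j, P j * (((z j).valMinAbs : ℝ))) = P 0 * ((z 0).valMinAbs : ℝ) + P 1 * ((z 1).valMinAbs : ℝ) := Fin.sum_univ_two _

/-! ## §4 Along the Fermi curve of a frame: the four reflected momenta are the Fermi points of the four reflected ANGLES -/

omit [NeZero L] in
/-- **`h_{|z̃₀|,|z̃₁|}(k_F(θ)) = ¼ Σ_{θ′ ∈ {θ, −θ, π/2−θ, π/2+θ}} cos(k_F(θ′)·z̃)`** for EVERY frame `K : TrigPolyC4v` (the frame is `D₄`-invariant,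
so its Fermi curve is: `klFermiPoint_neg/_pi_div_two_sub`). [cite: BenfattoGiulianiMastropietro2006, §2.4] -/
theorem harmonic_klFermiPoint_eq_cos4 (μ : ℝ) (K : TrigPolyC4v) (θ : ℝ) (z : TorusSite 2 L) :
    TrigPolyC4v.harmonic (z 0).valMinAbs.natAbs (z 1).valMinAbs.natAbs (klFermiPoint μ K θ) =
      (Real.cos (∑ j, klFermiPoint μ K θ j * ((z j).valMinAbs : ℝ)) +
        Real.cos (∑ j, klFermiPoint μ K (-θ) j * ((z j).valMinAbs : ℝ)) +
        Real.cos (∑ j, klFermiPoint μ K (π / 2 - θ) j * ((z j).valMinAbs : ℝ)) +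
        Real.cos (∑ j, klFermiPoint μ K (π / 2 + θ) j * ((z j).valMinAbs : ℝ))) / 4 := by
  simp only [sum_two_mul_valMinAbs]
  rw [harmonic_natAbs_eq_cos4, show π / 2 + θ = π / 2 - (-θ) by ring, klFermiPoint_pi_div_two_sub μ K (-θ),
    klFermiPoint_pi_div_two_sub μ K θ, klFermiPoint_neg]
  simp only [Matrix.cons_val_zero, Matrix.cons_val_one]

/-- **EXACT INTERPOLATION OF CHARACTER DATA ALONG THE FERMI CURVE (cosine form).**  For `T(k⃗) = Re Σ_{i∈s} a_i χ_{k⃗}(z_i)`: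
`(symInterp L T).eval (k_F(θ)) = ¼ Σ_{θ′ ∈ {θ, −θ, π/2−θ, π/2+θ}} Re Σ_i a_i cos(k_F(θ′)·z̃_i)`. [cite: Zygmund2002, Ch. X §2] -/
theorem eval_symInterp_re_sum_mul_torusChar_klFermiPoint {ι : Type*} (s : Finset ι) (a : ι → ℂ) (z : ι → TorusSite 2 L)
    (μ : ℝ) (K : TrigPolyC4v) (θ : ℝ) :
    (symInterp L (fun k => (∑ i ∈ s, a i * torusChar k (z i)).re)).eval (klFermiPoint μ K θ) =
      ((∑ i ∈ s, a i * (Real.cos (∑ j, klFermiPoint μ K θ j * (((z i) j).valMinAbs : ℝ)) : ℂ)).re +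
        (∑ i ∈ s, a i * (Real.cos (∑ j, klFermiPoint μ K (-θ) j * (((z i) j).valMinAbs : ℝ)) : ℂ)).re +
        (∑ i ∈ s, a i * (Real.cos (∑ j, klFermiPoint μ K (π / 2 - θ) j * (((z i) j).valMinAbs : ℝ)) : ℂ)).re +
        (∑ i ∈ s, a i * (Real.cos (∑ j, klFermiPoint μ K (π / 2 + θ) j * (((z i) j).valMinAbs : ℝ)) : ℂ)).re) / 4 := by
  rw [eval_symInterp_re_sum_mul_torusChar]
  simp_rw [harmonic_klFermiPoint_eq_cos4 μ K θ]
  rw [← Complex.add_re, ← Complex.add_re, ← Complex.add_re, ← Finset.sum_add_distrib, ← Finset.sum_add_distrib, ← Finset.sum_add_distrib,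
    ← Complex.div_ofNat_re, Finset.sum_div]
  congr 1
  refine Finset.sum_congr rfl fun i _ => ?_
  push_cast
  ring

/-- **EXACT INTERPOLATION OF CHARACTER DATA ALONG THE FERMI CURVE (plane-wave form, eight images).**  For `T(k⃗) = Re charPoly(p_k⃗)`:
`(symInterp L T).eval (k_F(θ)) = ⅛ Σ_{θ′} Re charPoly(k_F(θ′))`, `θ′` over `{θ, −θ, π/2−θ, π/2+θ}` and their shifts by `π` (`k_F(θ′+π) = −k_F(θ′)`).
The jets of the interpolated reading are averages of the jets of ONE smooth function of the angle at eight angles. [cite: Zygmund2002, Ch. X §2] -/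
theorem eval_symInterp_re_charPoly_klFermiPoint {ι : Type*} (s : Finset ι) (a : ι → ℂ) (z : ι → TorusSite 2 L)
    (μ : ℝ) (K : TrigPolyC4v) (θ : ℝ) :
    (symInterp L (fun k => (charPoly s a z (latticeMomentum L k)).re)).eval (klFermiPoint μ K θ) =
      ((charPoly s a z (klFermiPoint μ K θ)).re + (charPoly s a z (klFermiPoint μ K (θ + π))).re +
        ((charPoly s a z (klFermiPoint μ K (-θ))).re + (charPoly s a z (klFermiPoint μ K (-θ + π))).re) +
        ((charPoly s a z (klFermiPoint μ K (π / 2 - θ))).re + (charPoly s a z (klFermiPoint μ K (π / 2 - θ + π))).re) +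
        ((charPoly s a z (klFermiPoint μ K (π / 2 + θ))).re + (charPoly s a z (klFermiPoint μ K (π / 2 + θ + π))).re)) / 8 := by
  simp_rw [charPoly_latticeMomentum]
  rw [eval_symInterp_re_sum_mul_torusChar_klFermiPoint, klFermiPoint_add_pi, klFermiPoint_add_pi, klFermiPoint_add_pi, klFermiPoint_add_pi,
    charPoly_re_add_charPoly_neg_re, charPoly_re_add_charPoly_neg_re, charPoly_re_add_charPoly_neg_re, charPoly_re_add_charPoly_neg_re]
  ring

end Summit.HubbardSuperconductivity.HubbardSuperconductivity.Theorems.C4a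

end
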